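import Summits.ABC.StewartYu.GenThreeInductionTwo
import HarnessLib

/-!
# Cell abc-stewartyu, WP-L.P(2) shell S2: the KUMMER-FREE Matveev induction at `p = 2`
# (internal statement = the SketchGA text `PadicCoreTwoRat`, per-rank dichotomy, strong induction)

`Summits/ABC/StewartYu/GenThreeInductionTwoRat.lean` — cell `abc-stewartyu` (HOME
`run/shared/lean/pub/abc-stewartyu/`), seat p3 (designed g8, filed g9 on the A1.L tranche GO, HUMAN D-0137
2026-08-27), SHELL layer S2 of the 𝔑-threaded (Kummer-free) `2`-adic Gen-3 frame of route `YuMatveevShapeRat`,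
crux r4 `PadicCoreTwoRat` (HOME/p3/memo-11 §3, HOME/p2/memo-07 §2 row «shells»).  Twin of `GenThreeInductionTwo` (p3-g5, p466813) with the cube-Kummer binder DELETED
everywhere: the internal statement of the 𝔑-threaded `2`-adic Gen-3 engine is the Kummer-free core
`CoreTwoRat C r` (= the body of the route crux `PadicCoreTwoRat` of HOME/plan/routeGA-v2/SketchGA.v2.lean —
the FROZEN text, = the hypothesis `hTwo` of `Dioph.approximationBound_rat_of_cores` — at the constant function `C`), the step data `StepTwoRat` carry NO Kummer clause (each rank instance of
the frame saturates internally — memo-07 §0, memo-10), and Matveev's strong induction `core_of_dichotomy`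
is verbatim.  The valuation lemmas (`padicValRat_le_of_pow_eq`,
`three_le_padicValRat_prod_zpow_sub_one`) are imported from the landed file (they never used Kummer).
Last theorem: the SketchGA text from `∀ r, CoreTwoRat C r` with `0 ≤ C r ≤ c₁ʳ`.

WHAT THIS IS NOT: no analytic content; no frame; nothing about the rung (support library; A1.L not moved).

References: Yu. V. Nesterenko, LNM 1819 (2003), Thm 2.1 from Prop. 2.6, §5.2 (5.22); K. Yu, Forum
Math. 19 (2007), Main Theorem (`K = ℚ`, `℘ = 2`); HOME/p3/memo-10, memo-11; HOME/p2/memo-07.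
-/

noncomputable section

open Finset

namespace Summit.ABC.StewartYu.GenThreeInductionTwoRat

/-! ### The Kummer-free internal statement, the step data, the dichotomy -/

/-- **The Kummer-free internal statement of the 𝔑-threaded `p = 2` engine at rank `r`**: for rational
`2`-adic principal units `θᵢ ≡ 1 (mod 8)`, multiplicatively independent (NO Kummer condition), weights
`h(θᵢ) ≤ Aᵢ`, `1 ≤ Aᵢ ≤ Amax`, exponents `m ≠ 0` with `log max(3,|mᵢ|) ≤ W`, `1 ≤ W`:
`ord₂(∏ θᵢ^{mᵢ} − 1) ≤ C(r)·∏ Aᵢ·(W + log 2Amax)` — the body of SketchGA's `PadicCoreTwoRat` at the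
constant function `C`. [cite: Yu2007, Main Thm (K = ℚ, ℘ = 2); shape only] -/
def CoreTwoRat (C : ℕ → ℝ) (r : ℕ) : Prop :=
  ∀ (θ : Fin r → ℚ) (m : Fin r → ℤ) (A : Fin r → ℝ) (Amax W : ℝ),
    (∀ i, 3 ≤ padicValRat 2 (θ i - 1)) →
    (∀ μ : Fin r → ℤ, ∏ i, θ i ^ μ i = 1 → μ = 0) →
    (∀ i, Height.logHeight₁ (θ i) ≤ A i) → (∀ i, 1 ≤ A i) → (∀ i, A i ≤ Amax) →
    m ≠ 0 → (∀ i, Real.log (max 3 (|m i| : ℝ)) ≤ W) → 1 ≤ W →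
    (padicValRat 2 (∏ i, θ i ^ m i - 1) : ℝ) ≤ C r * (∏ i, A i) * (W + Real.log (2 * Amax))

/-- **The data of one Kummer-free Matveev step at rank `n`**: a rank `r < n`, new generators / exponents /
weights satisfying every hypothesis of `CoreTwoRat C r`, the valuation comparison and the (5.22) cost
inequality. [cite: Nesterenko2003, Prop 2.6 and (5.22)] -/
def StepTwoRat (C : ℕ → ℝ) (n : ℕ) (α : Fin n → ℚ) (b : Fin n → ℤ) (V : Fin n → ℝ) (Vmax W : ℝ) :
    Prop :=
  ∃ (r : ℕ) (θ : Fin r → ℚ) (m : Fin r → ℤ) (A : Fin r → ℝ) (Amax W' : ℝ), r < n ∧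
    (∀ i, 3 ≤ padicValRat 2 (θ i - 1)) ∧
    (∀ μ : Fin r → ℤ, ∏ i, θ i ^ μ i = 1 → μ = 0) ∧
    (∀ i, Height.logHeight₁ (θ i) ≤ A i) ∧ (∀ i, 1 ≤ A i) ∧ (∀ i, A i ≤ Amax) ∧
    m ≠ 0 ∧ (∀ i, Real.log (max 3 (|m i| : ℝ)) ≤ W') ∧ 1 ≤ W' ∧
    padicValRat 2 (∏ j, α j ^ b j - 1) ≤ padicValRat 2 (∏ i, θ i ^ m i - 1) ∧
    C r * (∏ i, A i) * (W' + Real.log (2 * Amax)) ≤ C n * (∏ j, V j) * (W + Real.log (2 * Vmax))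

/-- **The Kummer-free per-rank dichotomy** delivered by the 𝔑-threaded frame at rank `n`: the bound, or a
Kummer-free Matveev step. [cite: Nesterenko2003, Prop 2.6] -/
def DichotomyTwoRat (C : ℕ → ℝ) (n : ℕ) : Prop :=
  ∀ (α : Fin n → ℚ) (b : Fin n → ℤ) (V : Fin n → ℝ) (Vmax W : ℝ),
    (∀ j, 3 ≤ padicValRat 2 (α j - 1)) →
    (∀ μ : Fin n → ℤ, ∏ j, α j ^ μ j = 1 → μ = 0) →
    (∀ j, Height.logHeight₁ (α j) ≤ V j) → (∀ j, 1 ≤ V j) → (∀ j, V j ≤ Vmax) →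
    b ≠ 0 → (∀ j, Real.log (max 3 (|b j| : ℝ)) ≤ W) → 1 ≤ W →
    (padicValRat 2 (∏ j, α j ^ b j - 1) : ℝ) ≤ C n * (∏ j, V j) * (W + Real.log (2 * Vmax)) ∨
      StepTwoRat C n α b V Vmax W

/-! ### The induction -/

/-- **Matveev's induction on the number of logarithms, Kummer-free form**: the per-rank dichotomy for every
rank gives the internal statement for every rank. [cite: Nesterenko2003, Thm 2.1 from Prop 2.6] -/
theorem core_of_dichotomy {C : ℕ → ℝ} (hD : ∀ n, DichotomyTwoRat C n) : ∀ r, CoreTwoRat C r := by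
  intro r
  induction r using Nat.strong_induction_on with
  | _ n ih =>
    intro α b V Vmax W hα hind hV hV1 hVmax hb hW hW1
    rcases hD n α b V Vmax W hα hind hV hV1 hVmax hb hW hW1 with hle | hstep
    · exact hle
    · obtain ⟨r, θ, m, A, Amax, W', hr, hθ, hindθ, hA, hA1, hAmax, hm, hW', hW1', hval, hcost⟩ :=
        hstep
      have hIH := ih r hr θ m A Amax W' hθ hindθ hA hA1 hAmax hm hW' hW1'
      have hval' : (padicValRat 2 (∏ j, α j ^ b j - 1) : ℝ) ≤
          (padicValRat 2 (∏ i, θ i ^ m i - 1) : ℝ) := by exact_mod_cast hval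
      exact hval'.trans (hIH.trans hcost)

/-- The frame's working form of the Kummer-free dichotomy: ASSUME the negated bound and produce the step.
[cite: Nesterenko2003, §5.2] -/
theorem dichotomy_of_not_le {C : ℕ → ℝ} {n : ℕ}
    (h : ∀ (α : Fin n → ℚ) (b : Fin n → ℤ) (V : Fin n → ℝ) (Vmax W : ℝ),
      (∀ j, 3 ≤ padicValRat 2 (α j - 1)) →
      (∀ μ : Fin n → ℤ, ∏ j, α j ^ μ j = 1 → μ = 0) →
      (∀ j, Height.logHeight₁ (α j) ≤ V j) → (∀ j, 1 ≤ V j) → (∀ j, V j ≤ Vmax) →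
      b ≠ 0 → (∀ j, Real.log (max 3 (|b j| : ℝ)) ≤ W) → 1 ≤ W →
      ¬ (padicValRat 2 (∏ j, α j ^ b j - 1) : ℝ) ≤ C n * (∏ j, V j) * (W + Real.log (2 * Vmax)) →
      StepTwoRat C n α b V Vmax W) :
    DichotomyTwoRat C n := by
  intro α b V Vmax W hα hind hV hV1 hVmax hb hW hW1
  by_cases hle : (padicValRat 2 (∏ j, α j ^ b j - 1) : ℝ) ≤
      C n * (∏ j, V j) * (W + Real.log (2 * Vmax))
  · exact Or.inl hle
  · exact Or.inr (h α b V Vmax W hα hind hV hV1 hVmax hb hW hW1 hle)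

/-- **The Kummer-free step from the algebraic relation** `∏ θᵐ = (∏ αᵇ)^{m₀}` (`m₀ ≠ 0`): rank-`r` data
(`r < n`) satisfying the hypotheses of `CoreTwoRat C r` and the cost inequality give `StepTwoRat` — the form
in which the END (zero estimate ∘ exits ∘ lattice lever, `θᵢ = ∏ αⱼ^{Zᵢⱼ}`, `m₀ b = ∑ mᵢ Zᵢ`) produces it;
no Kummer clause is owed. [cite: Nesterenko2003, Prop 2.6 (2.9)–(2.13)] -/
theorem stepTwoRat_of_pow_eq {C : ℕ → ℝ} {n : ℕ} {α : Fin n → ℚ} {b : Fin n → ℤ} {V : Fin n → ℝ}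
    {Vmax W : ℝ} (hα : ∀ j, 3 ≤ padicValRat 2 (α j - 1))
    (hind : ∀ μ : Fin n → ℤ, ∏ j, α j ^ μ j = 1 → μ = 0) (hb : b ≠ 0)
    {r : ℕ} (hr : r < n) (θ : Fin r → ℚ) (m : Fin r → ℤ) (A : Fin r → ℝ) (Amax W' : ℝ)
    (hθ : ∀ i, 3 ≤ padicValRat 2 (θ i - 1))
    (hindθ : ∀ μ : Fin r → ℤ, ∏ i, θ i ^ μ i = 1 → μ = 0)
    (hA : ∀ i, Height.logHeight₁ (θ i) ≤ A i) (hA1 : ∀ i, 1 ≤ A i) (hAmax : ∀ i, A i ≤ Amax)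
    (hW' : ∀ i, Real.log (max 3 (|m i| : ℝ)) ≤ W') (hW1' : 1 ≤ W')
    (m₀ : ℤ) (hm₀ : m₀ ≠ 0) (hrel : ∏ i, θ i ^ m i = (∏ j, α j ^ b j) ^ m₀)
    (hcost : C r * (∏ i, A i) * (W' + Real.log (2 * Amax)) ≤
      C n * (∏ j, V j) * (W + Real.log (2 * Vmax))) :
    StepTwoRat C n α b V Vmax W := by
  -- `m ≠ 0`: otherwise `(∏ αᵇ)^{m₀} = 1` while `∏ αᵇ` is a principal unit `≠ 1`
  have hm : m ≠ 0 := by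
    intro hm0
    have hle := GenThreeInductionTwo.padicValRat_le_of_pow_eq α hα hind b hb θ m m₀ hm₀ hrel
    rw [hm0] at hle
    simp only [Pi.zero_apply, zpow_zero, Finset.prod_const_one, sub_self, padicValRat.zero] at hle
    have hne : ∏ j, α j ^ b j ≠ 1 := by
      intro h; apply hb; exact hind b h
    have h3 := GenThreeInductionTwo.three_le_padicValRat_prod_zpow_sub_one α hα b hne
    omega
  exact ⟨r, θ, m, A, Amax, W', hr, hθ, hindθ, hA, hA1, hAmax, hm, hW', hW1',
    GenThreeInductionTwo.padicValRat_le_of_pow_eq α hα hind b hb θ m m₀ hm₀ hrel, hcost⟩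

/-! ### The Kummer case is a special case (sanity link to the CLOSED crux) -/

/-- The Kummer-free core implies the Kummer-conditioned internal statement of the closed crux `Y07Two`
(drop one hypothesis). [cite: Yu2007, Main Thm (K = ℚ, ℘ = 2); shape only] -/
theorem coreTwo_of_coreTwoRat {C : ℕ → ℝ} {r : ℕ} (h : CoreTwoRat C r) :
    GenThreeInductionTwo.CoreTwo C r :=
  fun θ m A Amax W hθ hind _hK hA hA1 hAmax hm hW hW1 => h θ m A Amax W hθ hind hA hA1 hAmax hm hW hW1

/-! ### The SketchGA crux text from the core -/

/-- **The route crux text `PadicCoreTwoRat` (HOME/plan/routeGA-v2/SketchGA.v2.lean, byte-verbatim; = the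
hypothesis `hTwo` of `Literature.NumberTheory.DiophantineGeometry.Dioph.approximationBound_rat_of_cores` /
`padicApproximationBound_rat_of_padicCores` and of `Summit.ABC.StewartYu.padicHalf_of_padicCores`) from the
Kummer-free internal statement at every rank**, for one admissible `0 ≤ C r ≤ c₁ʳ`.
[cite: Yu2007, Main Thm (K = ℚ, ℘ = 2); shape only] -/
theorem padicCoreTwoRat_of_core {C : ℕ → ℝ} {c₁ : ℝ} (hC : ∀ r, 0 ≤ C r ∧ C r ≤ c₁ ^ r)
    (hcore : ∀ r, CoreTwoRat C r) :
    ∃ c : ℝ, ∀ (r : ℕ) (θ : Fin r → ℚ) (m : Fin r → ℤ) (A : Fin r → ℝ) (Amax W : ℝ),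
      (∀ i, 3 ≤ padicValRat 2 (θ i - 1)) →
      (∀ μ : Fin r → ℤ, ∏ i, θ i ^ μ i = 1 → μ = 0) →
      (∀ i, Height.logHeight₁ (θ i) ≤ A i) → (∀ i, 1 ≤ A i) → (∀ i, A i ≤ Amax) →
      m ≠ 0 → (∀ i, Real.log (max 3 (|m i| : ℝ)) ≤ W) → 1 ≤ W →
      (padicValRat 2 (∏ i, θ i ^ m i - 1) : ℝ) ≤
        c ^ r * (∏ i, A i) * (W + Real.log (2 * Amax)) := by
  refine ⟨c₁, ?_⟩
  intro r θ m A Amax W hθ hind hA hA1 hAmax hm hW hW1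
  have h := hcore r θ m A Amax W hθ hind hA hA1 hAmax hm hW hW1
  refine h.trans ?_
  have hprod : 0 ≤ ∏ i, A i := Finset.prod_nonneg fun i _ => (zero_le_one.trans (hA1 i))
  have hAmax1 : 1 ≤ Amax := by
    rcases Nat.eq_zero_or_pos r with hr | hr
    · -- `r = 0` forces `m = 0`, contradiction; any witness works but we do not need one:
      subst hr
      exact absurd (funext fun i => Fin.elim0 i) hm
    · exact (hA1 ⟨0, hr⟩).trans (hAmax ⟨0, hr⟩)
  have hlog : 0 ≤ W + Real.log (2 * Amax) := by
    have : 0 ≤ Real.log (2 * Amax) := Real.log_nonneg (by linarith)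
    linarith
  exact mul_le_mul_of_nonneg_right (mul_le_mul_of_nonneg_right (hC r).2 hprod) hlog

end Summit.ABC.StewartYu.GenThreeInductionTwoRat

end
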